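import Summits.Ventures.PercRepro.S1CoreCapRank
import Summits.Ventures.PercRepro.S1FiveCircuitsSolidSkeleton

/-!
# PercRepro — the parallel classes of `M ／ {e}` at a SIMPLE point `e`, the cost clause and the SPREAD clauses of the
4-circuit-cap spec, without the e-free hypothesis (p1, gen 34)

`proofs/P1-S2-CORANK6.md` §4n. The class machinery of `S1CoreCapClasses` (`cls M e p = cl {e, p} ∖ {e}`, the lines
`lineOf`, the configuration `config`, the points `pts`) and the rank bound of `S1CoreCapRank`
(`eRk_insert_pts_unionL_le`: the points of a list of lines of the configuration of `e`, with `e`, span rank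
`≤ lineRank l + 1`) use the e-free hypothesis `hfree` only through `eRk_pair_eq_two` — «two distinct points span
rank `2` with `e`». Here every consequence is re-proved from that single fact taken as the hypothesis
`hs : ∀ p ∈ M.E, e ≠ p → M.eRk {e, p} = 2` («`e` is simple»: `e` is a non-loop and no other point is a loop or
parallel to `e`), so that the bridge of the 4-circuit-cap spec can be run on the PLANE-POOR 8-SPREAD matroids of
the per-point table (`S1FiveCircuitsSolidSkeleton`), which are not e-free cores. Part 1 (`…_of_pair`): the class
lemmas of `S1CoreCapClasses` with `hfree` replaced by `hs`. Part 2: the rank bound and the COST CLAUSE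
`wsum (unionL l) ≤ ν + lineRank l` on every finite matroid of nullity `ν` in which `e` is simple. Part 3: the
8-SPREAD class (`Spread8 M`: no set of nullity `4` on `≤ 8` points) bounds every set of rank `≤ r ≤ 4` by `r + 3`
points (`ncard_le_add_three_of_eRk_le_of_spread8`: a basis plus four more points would be such a set), whence
the SPREAD CLAUSES of the plane-poor spec: a sub-family of rank bound `≤ 2` has weight `≤ 5`, one of rank bound
`≤ 3` has weight `≤ 6` (`wsum_unionL_le_add_three_of_lineRank_le`). Axioms: standard.
-/

open scoped Matroid

namespace PercRepro

namespace S1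

open Set

variable {α : Type}

/-- The line through `e` and a point `q` of the line through `e, p` is that line (simple-point form). -/
theorem closure_pair_eq_of_mem_of_pair (M : Matroid α) [M.Finite] {e : α}
    (hs : ∀ p ∈ M.E, e ≠ p → M.eRk {e, p} = 2) (he : e ∈ M.E) {p q : α} (hp : p ∈ M.E) (hep : e ≠ p)
    (hq : q ∈ cls M e p) : M.closure {e, q} = M.closure {e, p} := by
  have hqE : q ∈ M.E := mem_ground_of_mem_cls M hq
  have hqe : q ≠ e := ne_of_mem_cls M hq
  have h1 : M.closure {e, q} ⊆ M.closure {e, p} := by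
    refine M.closure_subset_closure_of_subset_closure ?_
    intro s hs'; simp only [mem_insert_iff, mem_singleton_iff] at hs'
    rcases hs' with rfl | rfl
    · exact M.mem_closure_of_mem' (by simp) he
    · exact hq.1
  refine le_antisymm h1 ?_
  refine M.closure_subset_closure_of_subset_closure ?_
  intro s hs'; simp only [mem_insert_iff, mem_singleton_iff] at hs'
  rcases hs' with rfl | rfl
  · exact M.mem_closure_of_mem' (by simp) he
  · by_contra hpcl
    have hins : M.eRk (insert s {e, q}) = M.eRk {e, q} + 1 := M.eRk_insert_eq_add_one ⟨hp, hpcl⟩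
    have hsub : insert s {e, q} ⊆ M.closure {e, s} := by
      intro t ht; simp only [mem_insert_iff, mem_singleton_iff] at ht
      rcases ht with rfl | rfl | rfl
      · exact M.mem_closure_of_mem' (by simp) hp
      · exact M.mem_closure_of_mem' (by simp) he
      · exact hq.1
    have hle : M.eRk (insert s {e, q}) ≤ 2 := by
      refine (M.eRk_mono hsub).trans ?_; rw [M.eRk_closure_eq]; exact eRk_pair_le_two M e s
    rw [hins, hs q hqE hqe.symm] at hle
    exact absurd hle (by decide)

/-- Classes are well defined at a simple point: the class of a point of `cls e p` is `cls e p`. -/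
theorem cls_eq_of_mem_of_pair (M : Matroid α) [M.Finite] {e : α}
    (hs : ∀ p ∈ M.E, e ≠ p → M.eRk {e, p} = 2) (he : e ∈ M.E) {p q : α} (hp : p ∈ M.E) (hep : e ≠ p)
    (hq : q ∈ cls M e p) : cls M e q = cls M e p := by
  unfold cls; rw [closure_pair_eq_of_mem_of_pair M hs he hp hep hq]

/-- Distinct classes at a simple point are disjoint. -/
theorem cls_disjoint_of_ne_of_pair (M : Matroid α) [M.Finite] {e : α}
    (hs : ∀ p ∈ M.E, e ≠ p → M.eRk {e, p} = 2) (he : e ∈ M.E) {p q : α} (hp : p ∈ M.E) (hq : q ∈ M.E)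
    (hep : e ≠ p) (heq : e ≠ q) (hne : cls M e p ≠ cls M e q) : Disjoint (cls M e p) (cls M e q) := by
  rw [Set.disjoint_left]
  intro t htp htq
  exact hne ((cls_eq_of_mem_of_pair M hs he hp hep htp).symm.trans (cls_eq_of_mem_of_pair M hs he hq heq htq))

/-- Two points of distinct classes at a simple point are independent with `e`: `r {e, p, q} = 3`. -/
theorem eRk_triple_eq_three_of_cls_ne_of_pair (M : Matroid α) [M.Finite] {e : α}
    (hs : ∀ p ∈ M.E, e ≠ p → M.eRk {e, p} = 2) (he : e ∈ M.E) {p q : α} (hp : p ∈ M.E) (hq : q ∈ M.E)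
    (hep : e ≠ p) (heq : e ≠ q) (hne : cls M e p ≠ cls M e q) : M.eRk {e, p, q} = 3 := by
  have hqcl : q ∉ M.closure {e, p} := by
    intro hqcl
    exact hne (cls_eq_of_mem_of_pair M hs he hp hep ⟨hqcl, fun h => heq (mem_singleton_iff.1 h).symm⟩).symm
  have h1 : ({e, p, q} : Set α) = insert q {e, p} := by
    ext t; simp only [mem_insert_iff, mem_singleton_iff]; tauto
  rw [h1, M.eRk_insert_eq_add_one ⟨hq, hqcl⟩, hs p hp hep]
  rfl

/-- The number of points of a set of pairwise distinct classes at a simple point is the sum of the class sizes. -/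
theorem ncard_pts_eq_sum_of_pair (M : Matroid α) [M.Finite] {e : α}
    (hs : ∀ p ∈ M.E, e ≠ p → M.eRk {e, p} = 2) (he : e ∈ M.E) (L : Finset (Set α))
    (hL : ∀ v ∈ L, ∃ q ∈ M.E, q ≠ e ∧ v = cls M e q) : (pts L).ncard = ∑ v ∈ L, v.ncard := by
  classical
  induction L using Finset.induction_on with
  | empty => simp [pts_empty]
  | insert v S hvS ih =>
    rw [pts_insert, Finset.sum_insert hvS, ← ih (fun u hu => hL u (Finset.mem_insert_of_mem hu))]
    obtain ⟨q, hqE, hqe, rfl⟩ := hL v (Finset.mem_insert_self v S)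
    have hfinS : (pts S).Finite := by
      unfold pts
      refine Set.Finite.sUnion (Finset.finite_toSet S) (fun u hu => ?_)
      obtain ⟨r, _, _, rfl⟩ := hL u (Finset.mem_insert_of_mem (Finset.mem_coe.1 hu))
      exact cls_finite M e r
    refine ncard_union_eq ?_ (cls_finite M e q) hfinS
    unfold pts
    rw [disjoint_sUnion_right]
    intro u hu
    obtain ⟨r, hrE, hre, rfl⟩ := hL u (Finset.mem_insert_of_mem (Finset.mem_coe.1 hu))
    refine cls_disjoint_of_ne_of_pair M hs he hqE hrE hqe.symm hre.symm ?_
    intro heq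
    exact hvS (heq ▸ Finset.mem_coe.1 hu)

/-- A set of distinct classes at a simple point has at most as many members as points. -/
theorem card_le_ncard_pts_of_pair (M : Matroid α) [M.Finite] {e : α}
    (hs : ∀ p ∈ M.E, e ≠ p → M.eRk {e, p} = 2) (he : e ∈ M.E) (L : Finset (Set α))
    (hL : ∀ v ∈ L, ∃ q ∈ M.E, q ≠ e ∧ v = cls M e q) : L.card ≤ (pts L).ncard := by
  rw [ncard_pts_eq_sum_of_pair M hs he L hL, Finset.card_eq_sum_ones]
  refine Finset.sum_le_sum (fun v hv => ?_)
  obtain ⟨q, hqE, hqe, rfl⟩ := hL v hv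
  exact ncard_pos (cls_finite M e q) |>.2 ⟨q, mem_cls_self M hqE hqe.symm⟩

/-- At a simple point, `e` is a non-loop as soon as the ground set has a second point. -/
theorem isNonloop_of_pair (M : Matroid α) {e : α} (hs : ∀ p ∈ M.E, e ≠ p → M.eRk {e, p} = 2) (he : e ∈ M.E)
    {p : α} (hp : p ∈ M.E) (hep : e ≠ p) : M.IsNonloop e := by
  refine Matroid.isNonloop_of_not_isLoop he (fun hl => ?_)
  have h1 : M.eRk {e, p} ≤ 1 := by
    have : ({e, p} : Set α) = insert e {p} := rfl
    rw [this, ← M.eRk_closure_eq, Matroid.closure_insert_eq_of_mem_closure (hl.mem_closure {p}),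
      M.eRk_closure_eq]
    exact M.eRk_singleton_le p
  rw [hs p hp hep] at h1
  exact absurd h1 (by decide)


/-! ### The rank bound and the cost clause at a simple point -/

open FourCap

open Classical in
/-- **The rank bound of the cost model at a simple point**: for any list of lines of the configuration of `e`, the
points of their classes together with `e` span rank at most `lineRank l + 1` in `M`. -/
theorem eRk_insert_pts_unionL_le_of_pair (M : Matroid α) [M.Finite] {e : α}
    (hs : ∀ p ∈ M.E, e ≠ p → M.eRk {e, p} = 2) (he : e ∈ M.E) :
    ∀ l : List (Finset (Set α)), (∀ L ∈ l, L ∈ config M e) →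
      M.eRk (insert e (pts (unionL l))) ≤ (lineRank l : ℕ∞) + 1
  | [], _ => by
    simp only [unionL, pts_empty, insert_empty_eq, lineRank, Nat.cast_zero, zero_add]
    exact (M.eRk_le_encard _).trans (by rw [encard_singleton])
  | L :: l, h => by
    have ih := eRk_insert_pts_unionL_le_of_pair M hs he l (fun L' hL' => h L' (List.mem_cons_of_mem L hL'))
    have hL := h L List.mem_cons_self
    obtain ⟨C, ⟨hC, h4, heC⟩, rfl⟩ := mem_config.1 hL
    have hCE : C ⊆ M.E := hC.subset_ground
    set U := insert e (pts (unionL l)) with hU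
    set P := M.closure C with hP
    have hPE : P ⊆ M.E := M.closure_subset_ground C
    have heP : e ∈ P := M.mem_closure_of_mem' heC (hCE heC)
    have hptsE : pts (unionL l) ⊆ M.E := by
      intro t ht
      obtain ⟨u, hu, htu⟩ := mem_pts.1 ht
      have : ∃ L' ∈ l, u ∈ L' := mem_unionL_iff.1 hu
      obtain ⟨L', hL', huL'⟩ := this
      obtain ⟨r, _, _, rfl⟩ := exists_rep_of_mem_config (h L' (List.mem_cons_of_mem _ hL')) huL'
      exact mem_ground_of_mem_cls M htu
    have hUE : U ⊆ M.E := insert_subset he hptsE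
    have hptsL : pts (lineOf M e C) = P \ {e} := pts_lineOf M hCE heC
    have hgoal : insert e (pts (unionL (lineOf M e C :: l))) = U ∪ P := by
      simp only [unionL]
      rw [pts_union, hptsL]
      ext t
      simp only [hU, mem_insert_iff, mem_union, mem_sdiff, mem_singleton_iff]
      by_cases hte : t = e
      · subst hte; simp [heP]
      · simp [hte]; tauto
    -- `e` is a non-loop: the 4-circuit `C` has a point other than `e`
    have hnl : M.IsNonloop e := by
      have hCfin : C.Finite := M.ground_finite.subset hCE
      have h3 : (C \ {e}).ncard = 3 := by
        have := ncard_sdiff_singleton_add_one heC hCfin; omega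
      obtain ⟨p, hp⟩ := nonempty_of_ncard_ne_zero (by omega : (C \ {e}).ncard ≠ 0)
      exact isNonloop_of_pair M hs he (hCE hp.1) (fun h => hp.2 (mem_singleton_iff.2 h.symm))
    -- Bound A: the new classes
    have hA : M.eRk (U ∪ P) ≤ M.eRk U + ((lineOf M e C \ unionL l).card : ℕ∞) := by
      have h1 : U ∪ P = U ∪ pts (lineOf M e C \ unionL l) := by
        ext t; constructor
        · rintro (ht | ht)
          · exact Or.inl ht
          · by_cases hte : t = e
            · exact Or.inl (hte ▸ mem_insert e _)
            · have ht' : t ∈ pts (lineOf M e C) := hptsL ▸ ⟨ht, hte⟩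
              obtain ⟨v, hv, htv⟩ := mem_pts.1 ht'
              by_cases hvl : v ∈ unionL l
              · exact Or.inl (mem_insert_of_mem e (mem_pts.2 ⟨v, hvl, htv⟩))
              · exact Or.inr (mem_pts.2 ⟨v, Finset.mem_sdiff.2 ⟨hv, hvl⟩, htv⟩)
        · rintro (ht | ht)
          · exact Or.inl ht
          · have := pts_mono Finset.sdiff_subset ht
            rw [hptsL] at this
            exact Or.inr this.1
      rw [h1]
      exact eRk_union_pts_le M he hUE (mem_insert e _) _
        (fun v hv => exists_rep_of_mem_lineOf (Finset.mem_sdiff.1 hv).1)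
    -- Bound B: submodularity against the plane `P`
    have hB : M.eRk (U ∪ P) ≤ M.eRk U + ((2 - min (lineOf M e C ∩ unionL l).card 2 : ℕ) : ℕ∞) := by
      have hsub : M.eRk (U ∩ P) + M.eRk (U ∪ P) ≤ M.eRk U + 3 := by
        have := M.eRk_inter_add_eRk_union_le U P
        rwa [hP, eRk_closure_fourCircuit M hC h4] at this
      refine eRk_union_le_of_submod M hUE hPE hsub (min_le_right _ _) ?_
      set old := lineOf M e C ∩ unionL l with hold
      have hmemU : ∀ v ∈ old, ∀ q ∈ M.E, q ≠ e → v = cls M e q → q ∈ U ∩ P := by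
        intro v hv q hqE hqe hvq
        have hq : q ∈ v := hvq ▸ mem_cls_self M hqE hqe.symm
        refine ⟨mem_insert_of_mem e (mem_pts.2 ⟨v, (Finset.mem_inter.1 hv).2, hq⟩), ?_⟩
        have : q ∈ pts (lineOf M e C) := mem_pts.2 ⟨v, (Finset.mem_inter.1 hv).1, hq⟩
        rw [hptsL] at this
        exact this.1
      rcases Nat.lt_or_ge old.card 2 with hlt | hge
      · rcases Nat.lt_or_ge old.card 1 with h0 | h1
        · have hm : min old.card 2 = 0 := by omega
          rw [hm, Nat.cast_zero, zero_add]
          rw [← hnl.eRk_eq]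
          exact M.eRk_mono (singleton_subset_iff.2 ⟨mem_insert e _, heP⟩)
        · have hm : min old.card 2 = 1 := by omega
          rw [hm]
          obtain ⟨v, hv⟩ := Finset.card_pos.1 h1
          obtain ⟨q, hqE, hqe, rfl⟩ := exists_rep_of_mem_lineOf (Finset.mem_inter.1 hv).1
          have hq := hmemU _ hv q hqE hqe rfl
          have hle : M.eRk {e, q} ≤ M.eRk (U ∩ P) := by
            refine M.eRk_mono ?_
            intro t ht; simp only [mem_insert_iff, mem_singleton_iff] at ht
            rcases ht with rfl | rfl
            · exact ⟨mem_insert t _, heP⟩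
            · exact hq
          rw [hs q hqE hqe.symm] at hle
          exact le_of_eq_of_le (by norm_num) hle
      · have hm : min old.card 2 = 2 := by omega
        rw [hm]
        obtain ⟨v₁, hv₁, v₂, hv₂, hne⟩ := Finset.one_lt_card.1 hge
        obtain ⟨q₁, hq₁E, hq₁e, rfl⟩ := exists_rep_of_mem_lineOf (Finset.mem_inter.1 hv₁).1
        obtain ⟨q₂, hq₂E, hq₂e, rfl⟩ := exists_rep_of_mem_lineOf (Finset.mem_inter.1 hv₂).1
        have hq₁ := hmemU _ hv₁ q₁ hq₁E hq₁e rfl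
        have hq₂ := hmemU _ hv₂ q₂ hq₂E hq₂e rfl
        have hle : M.eRk {e, q₁, q₂} ≤ M.eRk (U ∩ P) := by
          refine M.eRk_mono ?_
          intro t ht; simp only [mem_insert_iff, mem_singleton_iff] at ht
          rcases ht with rfl | rfl | rfl
          · exact ⟨mem_insert t _, heP⟩
          · exact hq₁
          · exact hq₂
        rw [eRk_triple_eq_three_of_cls_ne_of_pair M hs he hq₁E hq₂E hq₁e.symm hq₂e.symm hne] at hle
        exact le_of_eq_of_le (by norm_num) hle
    have hmin : M.eRk (U ∪ P) ≤ M.eRk U +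
        ((min (lineOf M e C \ unionL l).card (2 - min (lineOf M e C ∩ unionL l).card 2) : ℕ) : ℕ∞) := by
      rcases Nat.le_total (lineOf M e C \ unionL l).card (2 - min (lineOf M e C ∩ unionL l).card 2) with hle | hle
      · rw [Nat.min_eq_left hle]; exact hA
      · rw [Nat.min_eq_right hle]; exact hB
    rw [hgoal]
    calc M.eRk (U ∪ P) ≤ M.eRk U + _ := hmin
      _ ≤ ((lineRank l : ℕ∞) + 1) + _ := add_le_add ih (le_refl _)
      _ = (lineRank (lineOf M e C :: l) : ℕ∞) + 1 := by simp only [lineRank]; push_cast; ring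


/-! ### The cost clause and the spread clauses -/

open Classical in
/-- **The cost clause** at a simple point: `wsum (unionL l) ≤ ν + lineRank l` for every list of lines of the
configuration of `e` on a finite matroid of nullity `ν`. -/
theorem wsum_unionL_le_of_pair (M : Matroid α) [M.Finite] {e : α}
    (hs : ∀ p ∈ M.E, e ≠ p → M.eRk {e, p} = 2) {d : ℕ} (hd : M.E.encard = M.eRank + d) (he : e ∈ M.E)
    (l : List (Finset (Set α))) (hl : ∀ L ∈ l, L ∈ config M e) : wsum Set.ncard (unionL l) ≤ d + lineRank l := by
  have hcls : ∀ v ∈ unionL l, ∃ q ∈ M.E, q ≠ e ∧ v = cls M e q := fun v hv => exists_rep_of_mem_unionL hl hv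
  have hptsE : pts (unionL l) ⊆ M.E := by
    intro t ht
    obtain ⟨v, hv, htv⟩ := mem_pts.1 ht
    obtain ⟨q, _, _, rfl⟩ := hcls v hv
    exact mem_ground_of_mem_cls M htv
  have hX : insert e (pts (unionL l)) ⊆ M.E := insert_subset he hptsE
  have hr := eRk_insert_pts_unionL_le_of_pair M hs he l hl
  have h1 := ncard_le_of_eRk_le_add_nullity M hd hX (r := lineRank l + 1) (by exact_mod_cast hr)
  rw [ncard_insert_of_notMem (notMem_pts_of_classes hcls) (M.ground_finite.subset hptsE),
    ncard_pts_eq_sum_of_pair M hs he _ hcls] at h1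
  unfold wsum
  omega

/-- **The 8-spread class bounds the points of a set of small rank**: a set of rank `≤ r ≤ 4` of an 8-spread matroid
has at most `r + 3` points (a basis together with four further points of the set would be a set of nullity `4` on
`≤ 8` points). -/
theorem ncard_le_add_three_of_eRk_le_of_spread8 (N : Matroid α) [N.Finite] (hN8 : Spread8 N) {X : Set α}
    (hX : X ⊆ N.E) {r : ℕ} (hr : N.eRk X ≤ r) (hr4 : r ≤ 4) : X.ncard ≤ r + 3 := by
  by_contra h8
  push Not at h8
  obtain ⟨B, hB⟩ := N.exists_isBasis X hX
  have hBX : B ⊆ X := hB.subset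
  have hXfin : X.Finite := N.ground_finite.subset hX
  have hBfin : B.Finite := hXfin.subset hBX
  have hBr : B.encard = N.eRk X := hB.encard_eq_eRk
  have hBr' : B.ncard ≤ r := by
    have h1 : B.encard ≤ r := hBr ▸ hr
    rw [← hBfin.cast_ncard_eq] at h1
    exact_mod_cast h1
  have hdiff : (X \ B).ncard = X.ncard - B.ncard := ncard_sdiff hBX hBfin
  have h4 : 4 ≤ (X \ B).ncard := by omega
  obtain ⟨S, hSsub, hS4⟩ := Set.exists_subset_card_eq h4
  have hSX : S ⊆ X := hSsub.trans sdiff_subset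
  have hSfin : S.Finite := hXfin.subset hSX
  have hdisj : Disjoint B S := disjoint_of_subset_right hSsub disjoint_sdiff_right
  refine hN8 ⟨B ∪ S, union_subset (hBX.trans hX) (hSX.trans hX), ?_, ?_⟩
  · rw [ncard_union_eq hdisj hBfin hSfin]; omega
  · have hrW : N.eRk (B ∪ S) = N.eRk X := by
      refine le_antisymm (N.eRk_mono (union_subset hBX hSX)) ?_
      rw [← hB.eRk_eq_eRk]; exact N.eRk_mono subset_union_left
    rw [hrW, ← hBr, encard_union_eq hdisj, ← hSfin.cast_ncard_eq, hS4]
    rfl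

open Classical in
/-- **The spread clauses** at a simple point of an 8-spread matroid: a sub-family of the configuration of `e` with
rank bound `≤ r ≤ 3` has total weight `≤ r + 3` (its points with `e` span rank `≤ r + 1 ≤ 4`, hence number
`≤ r + 4`). In particular rank bound `≤ 2` ⟹ weight `≤ 5`, rank bound `≤ 3` ⟹ weight `≤ 6`. -/
theorem wsum_unionL_le_add_three_of_lineRank_le (M : Matroid α) [M.Finite] {e : α}
    (hs : ∀ p ∈ M.E, e ≠ p → M.eRk {e, p} = 2) (hN8 : Spread8 M) (he : e ∈ M.E)
    (l : List (Finset (Set α))) (hl : ∀ L ∈ l, L ∈ config M e) {r : ℕ} (hr : lineRank l ≤ r) (hr3 : r ≤ 3) :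
    wsum Set.ncard (unionL l) ≤ r + 3 := by
  have hcls : ∀ v ∈ unionL l, ∃ q ∈ M.E, q ≠ e ∧ v = cls M e q := fun v hv => exists_rep_of_mem_unionL hl hv
  have hptsE : pts (unionL l) ⊆ M.E := by
    intro t ht
    obtain ⟨v, hv, htv⟩ := mem_pts.1 ht
    obtain ⟨q, _, _, rfl⟩ := hcls v hv
    exact mem_ground_of_mem_cls M htv
  have hX : insert e (pts (unionL l)) ⊆ M.E := insert_subset he hptsE
  have hrk := eRk_insert_pts_unionL_le_of_pair M hs he l hl
  have hrk' : M.eRk (insert e (pts (unionL l))) ≤ ((r + 1 : ℕ) : ℕ∞) := by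
    refine hrk.trans ?_
    have : (lineRank l : ℕ∞) + 1 ≤ ((lineRank l + 1 : ℕ) : ℕ∞) := by push_cast; exact le_refl _
    refine this.trans ?_
    exact_mod_cast (by omega : lineRank l + 1 ≤ r + 1)
  have h1 := ncard_le_add_three_of_eRk_le_of_spread8 M hN8 hX hrk' (by omega)
  rw [ncard_insert_of_notMem (notMem_pts_of_classes hcls) (M.ground_finite.subset hptsE),
    ncard_pts_eq_sum_of_pair M hs he _ hcls] at h1
  unfold wsum
  omega

end S1

end PercRepro
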